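import Literature.RepresentationTheory.Ichino2022.FockKTypeCorrespondence
import HarnessLib

/-!
# Ichino (2022) §4.1 / Lemma 7.10 under a twist of the splitting character `χ_W`: the `K′`-type offsets

A. Ichino, *Theta lifting for tempered representations of real unitary groups*, Adv. Math. **398** (2022)
108188 = arXiv:2008.06174 [Ichino2022ThetaReal], §4.1 (the datum `χ_V = (·/|·|)^{m₀}`, `χ_W = (·/|·|)^{n₀}`,
`ψ = e^{−2π√−1x}`) and §7.5 Lemma 7.10 (the `K × K′`-types of the joint harmonics) — both transcribed in
`Literature.RepresentationTheory.Ichino2022.FockKTypeCorrespondence` (`SplittingDatum`, `HarmonicParam.mu/mu'`,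
the predicate `FockHarmonics.Lemma_7_10`; nothing asserted).  This file adds ARITHMETIC CONSEQUENCES of the
transcribed lemma, all proved:

* `SplittingDatum.twistW S m` — the datum with `χ_W` replaced by `χ_W · (·/|·|)^{2m}` (i.e. `n₀ ↦ n₀ + 2m`; the
  parity constraint `n₀ ≡ n (mod 2)` is kept).  In Lemma 7.10 the `U(V)`-side weight `μ′` carries the summand
  `(n₀/2, …, n₀/2)`, so the twist SHIFTS every `μ′` by `(m, …, m; m, …, m)` and leaves `μ` unchanged:
  `HarmonicParam.twistW/oftwistW`, `mu_twistW`, `mu'_twistW_fst/snd`, and, under Lemma 7.10 for both data,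
  `FockHarmonics.corresponds_shift_iff_of_twistW` (`μ ⊠ (μ′ + m)` harmonic for the twisted datum iff `μ ⊠ μ′`
  harmonic for the original one).
* symmetrically `SplittingDatum.twistV S m′` (`χ_V ↦ χ_V · (·/|·|)^{2m′}`, `m₀ ↦ m₀ + 2m′`) shifts every `μ` by
  `m′` and leaves `μ′` unchanged (`HarmonicParam.twistV`, `mu_twistV_fst/snd`, `mu'_twistV`): a twist on the
  `U(W)`-side splitting moves WHICH `K`-type of `U(W)` is paired with a given `K′`-type, never the `K′`-types.
* the OFFSET at the signature `(p,q;r,s) = (1,0;2,1)` (the pair `(U(1), U(2,1))`): for every parameter `P`,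
  `μ′ = ((1+n₀)/2 + a, (1+n₀)/2 ; (n₀−1)/2 + b)` with `a ≥ 0 ≥ b` integers (`mu'_fst_one_1021`,
  `mu'_fst_zero_1021`, `mu'_snd_zero_1021`), so the middle entry of any harmonic `K′ = U(2) × U(1)`-type READS OFF
  `n₀` (`n₀_eq_of_corresponds_1021`), and the twist normalising `n₀` to any prescribed value of the right parity is
  unique (`existsUnique_twistW_n₀_eq`).

Why (Hodge-CM cell, D5-arch ingredient (b) / HAZARD γ-K): two continuous splittings of the metaplectic cover over
a real unitary group differ by a continuous character of that group, which on the diagonal torus is `det^m`, `m ∈ ℤ`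
(tree `Geometry/ComplexHyperbolic/UnitaryGroupTorusCharacters(Integral)`, `Analysis/Complex/CircleCharacterClassification`;
for the compatible GLOBAL splittings of their three-variable unitary group Gelbart–Rogawski 1991, p. 457, Remark,
print that the difference is an automorphic character `ν₁` of `E¹` "regarded as a character of `G`"); at a real
place such a twist `z^m ∘ det` changes the archimedean Weil representation by `χ_W ↦ χ_W·(z/z̄)^m`, i.e. by
`twistW m`.  The lemmas here say exactly how the `K′`-types move and that the normalisation making the
holomorphic type `𝔭₊ = (1,0;−1)` harmonic (`n₀ = −1`, `FockKTypeWorkedLines.corresponds_pPlus_iff_posLine`) is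
reached by a unique twist.  No statement about a Weil representation is asserted; cite tags are provenance.

## References

* A. Ichino, Adv. Math. 398 (2022) 108188, §4.1, §7.5 Lemma 7.10. [Ichino2022ThetaReal]
* S. Gelbart, J. Rogawski, Invent. Math. 105 (1991) 445–472, §3.1 p. 457 Remark (for their `G`: compatible
  splittings differ by an automorphic character `ν₁` of `E¹` regarded as a character of `G`) — context only, not used.
-/

namespace Literature.RepresentationTheory.Ichino2022

/-! ## The twist of the `χ_W`-exponent -/

namespace SplittingDatum

/-- **Twist of the splitting character `χ_W`** by `(·/|·|)^{2m}`: the datum `(p,q;r,s; m₀, n₀ + 2m)` (parity of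
`n₀` unchanged). [cite: Ichino2022ThetaReal, §4.1] -/
def twistW (S : SplittingDatum) (m : ℤ) : SplittingDatum where
  p := S.p
  q := S.q
  r := S.r
  s := S.s
  m₀ := S.m₀
  n₀ := S.n₀ + 2 * m
  m₀_parity := S.m₀_parity
  n₀_parity := by
    have h := S.n₀_parity.add (Int.modEq_zero_iff_dvd.mpr ⟨m, rfl⟩ : 2 * m ≡ 0 [ZMOD 2])
    simpa using h

variable (S : SplittingDatum) (m : ℤ)

/-- The twist keeps `p`. [folklore] -/
@[simp] theorem twistW_p : (S.twistW m).p = S.p := rfl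
/-- The twist keeps `q`. [folklore] -/
@[simp] theorem twistW_q : (S.twistW m).q = S.q := rfl
/-- The twist keeps `r`. [folklore] -/
@[simp] theorem twistW_r : (S.twistW m).r = S.r := rfl
/-- The twist keeps `s`. [folklore] -/
@[simp] theorem twistW_s : (S.twistW m).s = S.s := rfl
/-- The twist keeps `m₀` (the `χ_V`-exponent). [folklore] -/
@[simp] theorem twistW_m₀ : (S.twistW m).m₀ = S.m₀ := rfl
/-- The twist replaces `n₀` by `n₀ + 2m`. [cite: Ichino2022ThetaReal, §4.1] -/
@[simp] theorem twistW_n₀ : (S.twistW m).n₀ = S.n₀ + 2 * m := rfl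

/-- The twist by `0` is the datum itself. [folklore] -/
theorem twistW_zero : S.twistW 0 = S := by
  cases S; simp [twistW]

/-- **Normalisation**: for every target exponent `t` of the same parity as `n₀` there is EXACTLY ONE twist with
`(S.twistW m).n₀ = t`, namely `m = (t − n₀)/2`. [folklore] -/
theorem existsUnique_twistW_n₀_eq (t : ℤ) (ht : t ≡ S.n₀ [ZMOD 2]) : ∃! m : ℤ, (S.twistW m).n₀ = t := by
  obtain ⟨k, hk⟩ := (Int.modEq_iff_dvd.mp ht.symm)
  refine ⟨k, ?_, ?_⟩
  · show S.n₀ + 2 * k = t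
    omega
  · intro m' hm'
    change S.n₀ + 2 * m' = t at hm'
    omega

/-- In particular the holomorphic normalisation `n₀ = −1` of an ODD exponent is reached by a unique twist.
[folklore] -/
theorem existsUnique_twistW_n₀_eq_neg_one (hodd : Odd S.n₀) : ∃! m : ℤ, (S.twistW m).n₀ = -1 := by
  refine S.existsUnique_twistW_n₀_eq (-1) ?_
  obtain ⟨k, hk⟩ := hodd
  exact Int.modEq_iff_dvd.mpr ⟨k + 1, by omega⟩

/-- **Twist of the splitting character `χ_V`** by `(·/|·|)^{2m′}`: the datum `(p,q;r,s; m₀ + 2m′, n₀)`.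
[cite: Ichino2022ThetaReal, §4.1] -/
def twistV (S : SplittingDatum) (m' : ℤ) : SplittingDatum where
  p := S.p
  q := S.q
  r := S.r
  s := S.s
  m₀ := S.m₀ + 2 * m'
  n₀ := S.n₀
  m₀_parity := by
    have h := S.m₀_parity.add (Int.modEq_zero_iff_dvd.mpr ⟨m', rfl⟩ : 2 * m' ≡ 0 [ZMOD 2])
    simpa using h
  n₀_parity := S.n₀_parity

/-- The `χ_V`-twist keeps `p`. [folklore] -/
@[simp] theorem twistV_p (m' : ℤ) : (S.twistV m').p = S.p := rfl
/-- The `χ_V`-twist keeps `q`. [folklore] -/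
@[simp] theorem twistV_q (m' : ℤ) : (S.twistV m').q = S.q := rfl
/-- The `χ_V`-twist keeps `r`. [folklore] -/
@[simp] theorem twistV_r (m' : ℤ) : (S.twistV m').r = S.r := rfl
/-- The `χ_V`-twist keeps `s`. [folklore] -/
@[simp] theorem twistV_s (m' : ℤ) : (S.twistV m').s = S.s := rfl
/-- The `χ_V`-twist replaces `m₀` by `m₀ + 2m′`. [cite: Ichino2022ThetaReal, §4.1] -/
@[simp] theorem twistV_m₀ (m' : ℤ) : (S.twistV m').m₀ = S.m₀ + 2 * m' := rfl
/-- The `χ_V`-twist keeps `n₀`. [folklore] -/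
@[simp] theorem twistV_n₀ (m' : ℤ) : (S.twistV m').n₀ = S.n₀ := rfl

end SplittingDatum

/-! ## Transport of the parameters of Lemma 7.10 along the twist -/

namespace HarmonicParam

variable {S : SplittingDatum}

/-- The parameters `(p±, q±, a, b, c, d)` of Lemma 7.10 do not involve `n₀`: transport to the twisted datum.
[cite: Ichino2022ThetaReal, §7.5 Lemma 7.10] -/
def twistW (P : HarmonicParam S) (m : ℤ) : HarmonicParam (S.twistW m) where
  pp := P.pp
  pm := P.pm
  qp := P.qp
  qm := P.qm
  a := P.a
  b := P.b
  c := P.c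
  d := P.d
  a_anti := P.a_anti
  b_anti := P.b_anti
  c_anti := P.c_anti
  d_anti := P.d_anti
  a_pos := P.a_pos
  b_neg := P.b_neg
  c_pos := P.c_pos
  d_neg := P.d_neg
  hp := P.hp
  hq := P.hq
  hr := P.hr
  hs := P.hs

/-- Transport back from the twisted datum. [cite: Ichino2022ThetaReal, §7.5 Lemma 7.10] -/
def oftwistW {m : ℤ} (P : HarmonicParam (S.twistW m)) : HarmonicParam S where
  pp := P.pp
  pm := P.pm
  qp := P.qp
  qm := P.qm
  a := P.a
  b := P.b
  c := P.c
  d := P.d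
  a_anti := P.a_anti
  b_anti := P.b_anti
  c_anti := P.c_anti
  d_anti := P.d_anti
  a_pos := P.a_pos
  b_neg := P.b_neg
  c_pos := P.c_pos
  d_neg := P.d_neg
  hp := P.hp
  hq := P.hq
  hr := P.hr
  hs := P.hs

variable (P : HarmonicParam S) (m : ℤ)

/-- The `U(W)`-side weight `μ` is unchanged by the twist. [cite: Ichino2022ThetaReal, §7.5 Lemma 7.10] -/
theorem mu_twistW : (P.twistW m).mu = P.mu := rfl

/-- The `U(V)`-side weight shifts by `m` in every entry, first block. [cite: Ichino2022ThetaReal, §7.5 Lemma 7.10] -/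
theorem mu'_twistW_fst (i : Fin S.r) : (P.twistW m).mu'.1 i = P.mu'.1 i + m := by
  rw [mu'_fst_apply, mu'_fst_apply]
  simp only [SplittingDatum.twistW_p, SplittingDatum.twistW_q, SplittingDatum.twistW_n₀]
  push_cast
  change pad S.r P.pp P.qm P.hr P.a P.d i + _ + _ = _
  ring

/-- The `U(V)`-side weight shifts by `m` in every entry, second block. [cite: Ichino2022ThetaReal, §7.5 Lemma 7.10] -/
theorem mu'_twistW_snd (j : Fin S.s) : (P.twistW m).mu'.2 j = P.mu'.2 j + m := by
  rw [mu'_snd_apply, mu'_snd_apply]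
  simp only [SplittingDatum.twistW_p, SplittingDatum.twistW_q, SplittingDatum.twistW_n₀]
  push_cast
  change pad S.s P.qp P.pm _ P.c P.b j + _ + _ = _
  ring

variable {m}

/-- `μ` of the transported-back parameter. [folklore] -/
theorem mu_oftwistW (P' : HarmonicParam (S.twistW m)) : P'.oftwistW.mu = P'.mu := rfl

/-- `μ′` of the transported-back parameter, first block: un-shift by `m`. [folklore] -/
theorem mu'_oftwistW_fst (P' : HarmonicParam (S.twistW m)) (i : Fin S.r) :
    P'.mu'.1 i = P'.oftwistW.mu'.1 i + m :=
  mu'_twistW_fst P'.oftwistW m i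

/-- `μ′` of the transported-back parameter, second block. [folklore] -/
theorem mu'_oftwistW_snd (P' : HarmonicParam (S.twistW m)) (j : Fin S.s) :
    P'.mu'.2 j = P'.oftwistW.mu'.2 j + m :=
  mu'_twistW_snd P'.oftwistW m j

/-- Transport of the parameters along the `χ_V`-twist. [cite: Ichino2022ThetaReal, §7.5 Lemma 7.10] -/
def twistV (P : HarmonicParam S) (m' : ℤ) : HarmonicParam (S.twistV m') where
  pp := P.pp
  pm := P.pm
  qp := P.qp
  qm := P.qm
  a := P.a
  b := P.b
  c := P.c
  d := P.d
  a_anti := P.a_anti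
  b_anti := P.b_anti
  c_anti := P.c_anti
  d_anti := P.d_anti
  a_pos := P.a_pos
  b_neg := P.b_neg
  c_pos := P.c_pos
  d_neg := P.d_neg
  hp := P.hp
  hq := P.hq
  hr := P.hr
  hs := P.hs

/-- The `U(V)`-side weight `μ′` is unchanged by the `χ_V`-twist. [cite: Ichino2022ThetaReal, §7.5 Lemma 7.10] -/
theorem mu'_twistV (m' : ℤ) : (P.twistV m').mu' = P.mu' := rfl

/-- The `U(W)`-side weight shifts by `m′` in every entry, first block. [cite: Ichino2022ThetaReal, §7.5 Lemma 7.10] -/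
theorem mu_twistV_fst (m' : ℤ) (i : Fin S.p) : (P.twistV m').mu.1 i = P.mu.1 i + m' := by
  rw [mu_fst_apply, mu_fst_apply]
  simp only [SplittingDatum.twistV_r, SplittingDatum.twistV_s, SplittingDatum.twistV_m₀]
  push_cast
  change pad S.p P.pp P.pm P.hp P.a P.b i + _ + _ = _
  ring

/-- The `U(W)`-side weight shifts by `m′` in every entry, second block. [cite: Ichino2022ThetaReal, §7.5 Lemma 7.10] -/
theorem mu_twistV_snd (m' : ℤ) (j : Fin S.q) : (P.twistV m').mu.2 j = P.mu.2 j + m' := by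
  rw [mu_snd_apply, mu_snd_apply]
  simp only [SplittingDatum.twistV_r, SplittingDatum.twistV_s, SplittingDatum.twistV_m₀]
  push_cast
  change pad S.q P.qp P.qm P.hq P.c P.d j + _ + _ = _
  ring

end HarmonicParam

/-- The shift `μ′ ↦ μ′ + (m, …, m; m, …, m)` of a `K′ = U(r) × U(s)`-weight. [folklore] -/
def KWt.shift {r s : ℕ} (μ' : KWt r s) (m : ℤ) : KWt r s := (fun i => μ'.1 i + m, fun j => μ'.2 j + m)

/-- Entries of the shifted weight, first block. [folklore] -/
@[simp] theorem KWt.shift_fst {r s : ℕ} (μ' : KWt r s) (m : ℤ) (i : Fin r) : (μ'.shift m).1 i = μ'.1 i + m := rfl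
/-- Entries of the shifted weight, second block. [folklore] -/
@[simp] theorem KWt.shift_snd {r s : ℕ} (μ' : KWt r s) (m : ℤ) (j : Fin s) : (μ'.shift m).2 j = μ'.2 j + m := rfl

namespace FockHarmonics

variable {S : SplittingDatum} {m : ℤ}

/-- **Lemma 7.10 under the twist**: if the lemma holds for the datum `S` (joint harmonics `D`) and for the
twisted datum `S.twistW m` (joint harmonics `D'`), then `μ ⊠ (μ′ + m)` is harmonic for the twisted datum iff
`μ ⊠ μ′` is harmonic for the original one — the `K′`-types move by `(m, …; m, …)`, the `K`-types do not move.
[cite: Ichino2022ThetaReal, §7.5 Lemma 7.10] -/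
theorem corresponds_shift_iff_of_twistW (D : FockHarmonics S) (D' : FockHarmonics (S.twistW m))
    (h : D.Lemma_7_10) (h' : D'.Lemma_7_10) (μ : KWt S.p S.q) (μ' : KWt S.r S.s) :
    D'.corresponds μ (μ'.shift m) ↔ D.corresponds μ μ' := by
  rw [h μ μ', h' μ (μ'.shift m)]
  constructor
  · rintro ⟨P', hμ, hμ'⟩
    refine ⟨P'.oftwistW, hμ, ?_⟩
    ext i
    · have e := congrArg (fun w : KWt S.r S.s => w.1 i) hμ'
      simp only [KWt.shift_fst] at e
      rw [HarmonicParam.mu'_oftwistW_fst] at e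
      exact_mod_cast (add_right_cancel e)
    · have e := congrArg (fun w : KWt S.r S.s => w.2 i) hμ'
      simp only [KWt.shift_snd] at e
      rw [HarmonicParam.mu'_oftwistW_snd] at e
      exact_mod_cast (add_right_cancel e)
  · rintro ⟨P, hμ, hμ'⟩
    refine ⟨P.twistW m, hμ, ?_⟩
    ext i
    · rw [KWt.shift_fst, HarmonicParam.mu'_twistW_fst, hμ']
    · rw [KWt.shift_snd, HarmonicParam.mu'_twistW_snd, hμ']

end FockHarmonics

/-! ## The offsets at the signature `(1,0;2,1)` — the pair `(U(1), U(2,1))` -/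

namespace HarmonicParam

variable {S : SplittingDatum} (P : HarmonicParam S)

/-- At `(p,q;r,s) = (1,0;2,1)` the SECOND `U(2)`-entry of every harmonic `μ′` is the offset `(1 + n₀)/2`
(independent of the parameter). [cite: Ichino2022ThetaReal, §7.5 Lemma 7.10] -/
theorem mu'_fst_one_1021 (hp : S.p = 1) (hq : S.q = 0) (hr : S.r = 2) :
    P.mu'.1 ⟨1, by omega⟩ = (1 + (S.n₀ : ℚ)) / 2 := by
  have hPp : P.pp + P.pm ≤ S.p := P.hp
  have hPq : P.qp + P.qm ≤ S.q := P.hq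
  rw [mu'_fst_apply, pad_mid _ _ _ _ (by simp; omega) (by simp; omega), hp, hq]
  push_cast
  ring

/-- At `(1,0;2,1)` the FIRST `U(2)`-entry of a harmonic `μ′` is the offset plus `a₁ ≥ 1` when `p⁺ = 1`, the
offset itself when `p⁺ = 0`. [cite: Ichino2022ThetaReal, §7.5 Lemma 7.10] -/
theorem mu'_fst_zero_1021 (hp : S.p = 1) (hq : S.q = 0) (hr : S.r = 2) :
    P.mu'.1 ⟨0, by omega⟩ =
      (1 + (S.n₀ : ℚ)) / 2 + (if h : 0 < P.pp then (P.a ⟨0, h⟩ : ℚ) else 0) := by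
  have hPp : P.pp + P.pm ≤ S.p := P.hp
  have hPq : P.qp + P.qm ≤ S.q := P.hq
  by_cases h0 : 0 < P.pp
  · rw [dif_pos h0, mu'_fst_apply, pad_head _ _ _ _ (by simpa using h0), hp, hq]
    push_cast
    ring
  · rw [dif_neg h0, mu'_fst_apply, pad_mid _ _ _ _ (by simp; omega) (by simp; omega), hp, hq]
    push_cast
    ring

/-- At `(1,0;2,1)` the `U(1)`-entry of a harmonic `μ′` is `(n₀ − 1)/2` plus `b₁ ≤ −1` when `p⁻ = 1`, and
`(n₀ − 1)/2` itself when `p⁻ = 0`. [cite: Ichino2022ThetaReal, §7.5 Lemma 7.10] -/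
theorem mu'_snd_zero_1021 (hp : S.p = 1) (hq : S.q = 0) (hs : S.s = 1) :
    P.mu'.2 ⟨0, by omega⟩ =
      ((S.n₀ : ℚ) - 1) / 2 + (if h : 0 < P.pm then (P.b ⟨0, h⟩ : ℚ) else 0) := by
  have hPp : P.pp + P.pm ≤ S.p := P.hp
  have hPq : P.qp + P.qm ≤ S.q := P.hq
  have hPs : P.pm + P.qp ≤ S.s := P.hs
  by_cases h0 : 0 < P.pm
  · rw [dif_pos h0, mu'_snd_apply, pad_tail _ _ _ _ (by simp; omega) (by simp; omega), hp, hq]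
    have hidx : (⟨(⟨0, by omega⟩ : Fin S.s).val - (S.s - P.pm), by omega⟩ : Fin P.pm) = ⟨0, h0⟩ :=
      Fin.ext (by simp)
    rw [hidx]
    push_cast
    ring
  · rw [dif_neg h0, mu'_snd_apply, pad_mid _ _ _ _ (by simp; omega) (by simp; omega), hp, hq]
    push_cast
    ring

/-- Hence the `U(1)`-entry is at most `(n₀ − 1)/2 = offset − 1`. [folklore] -/
theorem mu'_snd_zero_le_1021 (hp : S.p = 1) (hq : S.q = 0) (hs : S.s = 1) :
    P.mu'.2 ⟨0, by omega⟩ ≤ ((S.n₀ : ℚ) - 1) / 2 := by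
  rw [P.mu'_snd_zero_1021 hp hq hs]
  by_cases h0 : 0 < P.pm
  · rw [dif_pos h0]
    have hb : (P.b ⟨0, h0⟩ : ℚ) < 0 := by exact_mod_cast P.b_neg ⟨0, h0⟩
    linarith
  · rw [dif_neg h0]
    simp

end HarmonicParam

namespace FockHarmonics

variable {S : SplittingDatum} (D : FockHarmonics S)

/-- **The offset is read off any harmonic `K′`-type**: at `(1,0;2,1)`, under Lemma 7.10, if `μ ⊠ μ′` is
harmonic then `n₀ = 2·μ′₂ − 1` (second `U(2)`-entry). [cite: Ichino2022ThetaReal, §7.5 Lemma 7.10] -/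
theorem n₀_eq_of_corresponds_1021 (h : D.Lemma_7_10) (hp : S.p = 1) (hq : S.q = 0) (hr : S.r = 2)
    {μ : KWt S.p S.q} {μ' : KWt S.r S.s} (hc : D.corresponds μ μ') :
    (S.n₀ : ℚ) = 2 * μ'.1 ⟨1, by omega⟩ - 1 := by
  obtain ⟨P, -, rfl⟩ := (h _ _).mp hc
  rw [P.mu'_fst_one_1021 hp hq hr]
  ring

/-- And the `U(1)`-entry of a harmonic `K′`-type is at most `μ′₂ − 1`: the `U(1)`-weight never exceeds the
offset minus one (used by the `U(1)`-weight count of PerL Lemma 3.5). [cite: Ichino2022ThetaReal, §7.5 Lemma 7.10] -/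
theorem snd_le_of_corresponds_1021 (h : D.Lemma_7_10) (hp : S.p = 1) (hq : S.q = 0) (hr : S.r = 2)
    (hs : S.s = 1) {μ : KWt S.p S.q} {μ' : KWt S.r S.s} (hc : D.corresponds μ μ') :
    μ'.2 ⟨0, by omega⟩ ≤ μ'.1 ⟨1, by omega⟩ - 1 := by
  obtain ⟨P, -, rfl⟩ := (h _ _).mp hc
  rw [P.mu'_fst_one_1021 hp hq hr]
  have := P.mu'_snd_zero_le_1021 hp hq hs
  linarith

end FockHarmonics

end Literature.RepresentationTheory.Ichino2022
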